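import Mathlib
import Literature.Computability.Complexity.RangeAvoidance
import Literature.Computability.Complexity.SignDegreeXor
import Summits.PneNP.PneNP.Theorems.PstarSASDPLevel
import Summits.PneNP.PneNP.Theorems.PstarExpandingModel
import Summits.PneNP.PneNP.Theorems.PstarExpandingCount

/-!
# Density-uniform expanding typed `P⋆` instances, I: bad outcomes at ratio `(t+1)/t` and the union bound (cell `pnp-ideate`, ROUND-23 T23.1-B)

FRONTIER range-avoidance ladder, rung F-N3 context (restricted-model combinatorics; nothing here bears on `P` vs `NP`).
The ROUND-21 random typed model `PstarExpandingModel` (outcome `ω : Fin m → DPair N × DPair N`, instance `inst ω` on `N + N`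
variables) with the expansion RATIO THREADED: for `t ≥ 1` an outcome is `badT t r` if some `≤ r` outputs `J` read fewer than
`(5t+1)/(2t)·|J|` variables; otherwise `inst ω` is `(r, (t+1)/t)`-boundary expanding (`boundaryExpandingQ_of_not_badT`, via
`2|N(J)| ≤ |bdry J| + 4|J|`).  Threshold `vT t f = ((5t+1)f − 1)/(2t)` (`le_vT_of_lt`, `vT_le : ≤ 3f`, and the SLACK
`slack_le : (t−1)·f ≤ 2t·(3f − vT t f)` — the exponent `(t−1)/(2t)` of the density-uniform first moment), the cover by the
ROUND-21 cylinders `PstarExpandingCount.cylJ` and **the union bound** `card_badSetT_le`: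
`#badT ≤ Σ_{i<r} C(m, i+1)·C(2N, vT t (i+1))·((vT t (i+1))⁴/16)^{i+1}·Q^{m−(i+1)}`.  Part II (`PstarDensityExist`) does the estimate.
-/

set_option linter.dupNamespace false

open Finset Literature.Computability.Complexity
open Summit.PneNP.PneNP.Theorems.PstarSALevel (varSet bdry)
open Summit.PneNP.PneNP.Theorems.PstarSASDPLevel (BoundaryExpandingQ)
open Summit.PneNP.PneNP.Theorems.PstarSAClosure (nbhd)
open Summit.PneNP.PneNP.Theorems.PstarExpandingModel
open Summit.PneNP.PneNP.Theorems.PstarExpandingCount (cylJ mem_cylJ card_cylJ pairsOf card_pairsOf_le card_cylJ_le)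

namespace Summit.PneNP.PneNP.Theorems.PstarDensityCount

variable {n N m : ℕ}

/-! ## Vertex expansion ⇒ boundary expansion at ratio `(t+1)/t` -/

/-- **Vertex expansion ⇒ boundary expansion** (`k = 4`, ratio `(t+1)/t`): if every `≤ r` outputs `J` read at least
`(5t+1)/(2t)·|J|` variables then the instance is `(r, (t+1)/t)`-boundary expanding. -/
theorem boundaryExpandingQ_of_vertexExpanding (I : LocalMap 4 n m) (hI : ∀ j, Function.Injective (I.vars j)) (t r : ℕ)
    (h : ∀ J : Finset (Fin m), J.card ≤ r → (5 * t + 1) * J.card ≤ 2 * t * (nbhd I J).card) :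
    BoundaryExpandingQ (t + 1) t r I := by
  intro J hJ
  have h1 := h J hJ
  have h2 : t * (2 * (nbhd I J).card) ≤ t * ((bdry I J).card + 4 * J.card) := Nat.mul_le_mul_left t (two_card_nbhd_le I hI J)
  nlinarith [h1, h2]

/-! ## Bad outcomes -/

/-- An outcome is BAD at radius `r` and parameter `t` if some `≤ r` outputs read fewer than `(5t+1)/(2t)` variables each on
average. -/
def badT (t r : ℕ) (ω : Outcome N m) : Prop :=
  ∃ J : Finset (Fin m), J.card ≤ r ∧ ¬((5 * t + 1) * J.card ≤ 2 * t * (nbhd (inst ω) J).card)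

/-- A good outcome gives an `(r, (t+1)/t)`-boundary expanding instance. -/
theorem boundaryExpandingQ_of_not_badT (t r : ℕ) (ω : Outcome N m) (h : ¬badT t r ω) :
    BoundaryExpandingQ (t + 1) t r (inst ω) := by
  refine boundaryExpandingQ_of_vertexExpanding (inst ω) (fun j => slots_injective (ω j)) t r fun J hJ => ?_
  by_contra hlt
  exact h ⟨J, hJ, hlt⟩

/-- Badness is monotone in the radius. -/
theorem badT_mono {t r r' : ℕ} (hrr : r ≤ r') {ω : Outcome N m} (h : badT t r ω) : badT t r' ω := by
  obtain ⟨J, hJ, hbad⟩ := h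
  exact ⟨J, hJ.trans hrr, hbad⟩

/-! ## The threshold and the slack -/

/-- The threshold `vT t f = ((5t+1)f − 1)/(2t)`: the largest vertex count of a bad family of size `f ≥ 1`. -/
def vT (t f : ℕ) : ℕ := ((5 * t + 1) * f - 1) / (2 * t)

/-- A bad set of size `f` reads at most `vT t f` variables: `2tV < (5t+1)f ⇒ V ≤ vT t f`. -/
theorem le_vT_of_lt {t f V : ℕ} (ht : 1 ≤ t) (h : ¬((5 * t + 1) * f ≤ 2 * t * V)) : V ≤ vT t f := by
  unfold vT
  rw [Nat.le_div_iff_mul_le (by omega), Nat.mul_comm]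
  exact Nat.le_sub_one_of_lt (lt_of_not_ge h)

/-- `2t · vT t f ≤ (5t+1)f − 1`. -/
theorem two_t_vT_le (t f : ℕ) : 2 * t * vT t f ≤ (5 * t + 1) * f - 1 := by
  unfold vT
  rw [Nat.mul_comm]
  exact Nat.div_mul_le_self _ _

/-- `vT t f ≤ 3f`. -/
theorem vT_le (t f : ℕ) (ht : 1 ≤ t) : vT t f ≤ 3 * f := by
  unfold vT
  calc ((5 * t + 1) * f - 1) / (2 * t) ≤ (2 * t * (3 * f)) / (2 * t) :=
        Nat.div_le_div_right (by
          have : (5 * t + 1) * f ≤ 2 * t * (3 * f) := by nlinarith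
          omega)
    _ = 3 * f := Nat.mul_div_cancel_left _ (by omega)

/-- **The slack**: a bad family of size `f ≥ 1` repeats at least `(t−1)/(2t)·f` incidences, `(t−1)·f ≤ 2t·(3f − vT t f)`. -/
theorem slack_le (t f : ℕ) (ht : 1 ≤ t) (hf : 1 ≤ f) : (t - 1) * f ≤ 2 * t * (3 * f - vT t f) := by
  have h1 := two_t_vT_le t f
  have h2 := vT_le t f ht
  have h3 : 1 ≤ (5 * t + 1) * f := by nlinarith
  zify [h2, ht, h3] at h1 ⊢
  nlinarith

/-! ## The cover and its size -/

/-- The bad outcomes. -/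
noncomputable def badSetT (N m t r : ℕ) : Finset (Outcome N m) := by
  classical exact univ.filter fun ω => badT t r ω

/-- The covering family: over sizes `f = i + 1`, `i < r`, sets `J` of that size and pairs of total size `vT t f`. -/
def coverT (N m t r : ℕ) : Finset (Outcome N m) :=
  (Finset.range r).biUnion fun i => (univ.powersetCard (i + 1)).biUnion fun J =>
    (pairsOf N (vT t (i + 1))).biUnion fun AB => cylJ J AB.1 AB.2

/-- **Containment**: if `3r ≤ N`, every bad outcome lies in the cover. -/
theorem badSetT_subset {t : ℕ} (ht : 1 ≤ t) (r : ℕ) (hr : 3 * r ≤ N) : badSetT N m t r ⊆ coverT N m t r := by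
  classical
  intro ω hω
  simp only [badSetT, Finset.mem_filter, Finset.mem_univ, true_and] at hω
  obtain ⟨J, hJr, hJ⟩ := hω
  have hs : 1 ≤ J.card := by
    rw [Nat.one_le_iff_ne_zero]
    intro h0
    rw [Finset.card_eq_zero] at h0
    subst h0
    exact hJ (by simp)
  have hV : (nbhd (inst ω) J).card ≤ vT t J.card := le_vT_of_lt ht hJ
  have hvN : vT t J.card ≤ N := (vT_le t _ ht).trans (by omega)
  obtain ⟨A, B, hAB, hmem⟩ := exists_pair_of_small_nbhd ω J (vT t J.card) hvN hV
  simp only [coverT, Finset.mem_biUnion, Finset.mem_range, Finset.mem_powersetCard]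
  refine ⟨J.card - 1, by omega, J, ⟨Finset.subset_univ _, by omega⟩, (A, B), ?_, ?_⟩
  · simp only [pairsOf, Finset.mem_filter, Finset.mem_univ, true_and]
    rw [hAB]; congr 1; omega
  · exact mem_cylJ.2 hmem

/-! ## The union bound -/

/-- **The union bound.**  If `3r ≤ N` then
`|badT| ≤ Σ_{i<r} C(m, i+1)·C(2N, vT t (i+1))·((vT t (i+1))⁴/16)^{i+1}·Q^{m−(i+1)}`. -/
theorem card_badSetT_le {t : ℕ} (ht : 1 ≤ t) (r : ℕ) (hr : 3 * r ≤ N) :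
    ((badSetT N m t r).card : ℝ) ≤ ∑ i ∈ Finset.range r,
      (m.choose (i + 1) : ℝ) * ((N + N).choose (vT t (i + 1)) : ℝ) * ((vT t (i + 1) : ℝ) ^ 4 / 16) ^ (i + 1) *
        (Fintype.card (DPair N × DPair N) : ℝ) ^ (m - (i + 1)) := by
  classical
  have h0 : ((badSetT N m t r).card : ℝ) ≤ ((coverT N m t r).card : ℝ) := by
    exact_mod_cast Finset.card_le_card (badSetT_subset ht r hr)
  refine h0.trans ?_
  unfold coverT
  refine (Nat.cast_le.2 Finset.card_biUnion_le).trans ?_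
  push_cast
  refine Finset.sum_le_sum fun i _ => ?_
  refine (Nat.cast_le (α := ℝ).2 Finset.card_biUnion_le).trans ?_
  push_cast
  -- sum over J of size i+1
  have hJ : ∀ J ∈ (univ : Finset (Fin m)).powersetCard (i + 1),
      (((pairsOf N (vT t (i + 1))).biUnion fun AB => cylJ J AB.1 AB.2).card : ℝ) ≤
        ((N + N).choose (vT t (i + 1)) : ℝ) * ((vT t (i + 1) : ℝ) ^ 4 / 16) ^ (i + 1) *
          (Fintype.card (DPair N × DPair N) : ℝ) ^ (m - (i + 1)) := by
    intro J hJ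
    rw [Finset.mem_powersetCard] at hJ
    refine (Nat.cast_le (α := ℝ).2 Finset.card_biUnion_le).trans ?_
    push_cast
    have hterm : ∀ AB ∈ pairsOf N (vT t (i + 1)), ((cylJ J AB.1 AB.2).card : ℝ) ≤
        ((vT t (i + 1) : ℝ) ^ 4 / 16) ^ (i + 1) * (Fintype.card (DPair N × DPair N) : ℝ) ^ (m - (i + 1)) := by
      intro AB hAB
      simp only [pairsOf, Finset.mem_filter, Finset.mem_univ, true_and] at hAB
      have := card_cylJ_le (m := m) J hAB
      rwa [hJ.2] at this
    refine (Finset.sum_le_sum hterm).trans ?_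
    rw [Finset.sum_const, nsmul_eq_mul]
    have hp : ((pairsOf N (vT t (i + 1))).card : ℝ) ≤ ((N + N).choose (vT t (i + 1)) : ℝ) := by
      exact_mod_cast card_pairsOf_le N (vT t (i + 1))
    have hnn : (0 : ℝ) ≤ ((vT t (i + 1) : ℝ) ^ 4 / 16) ^ (i + 1) *
        (Fintype.card (DPair N × DPair N) : ℝ) ^ (m - (i + 1)) := by positivity
    nlinarith
  refine (Finset.sum_le_sum hJ).trans ?_
  have hc : ((univ : Finset (Fin m)).powersetCard (i + 1)).card = m.choose (i + 1) := by
    rw [Finset.card_powersetCard, Finset.card_univ, Fintype.card_fin]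
  rw [Finset.sum_const, nsmul_eq_mul, hc]
  exact le_of_eq (by ring)

end Summit.PneNP.PneNP.Theorems.PstarDensityCount
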